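import Mathlib
import Summits.Ventures.PercRepro2.TypedLBBridges

/-!
# The double-attachment class of `o ~ {u, b}`, any `u`, from the two-copy rows in both
orientations (blind cell PercRepro2, night-3 g16, 2026-08-27; NIGHT3-CERT.md §25.7–25.8)

`doubleClass_ob_nonneg_of_rows`: for `e = {o, u}` (ANY `u`), `f = {o, b}` typed of type `1` at a
mark `o` of typed degree two (the other edges at `o` pinned closed), the double-attachment class is
nonnegative under `CrossCount a₁ a₂ b a₃`, `SameCount a₂ a₁ b a₃` and their root mirrors
`CrossCount a₂ a₁ b a₃`, `SameCount a₁ a₂ b a₃` — the probe copy is split by the side of `o`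
(`probeB_lb` / `probeB_hb` / `probeB_isolated` / `probeB_q'`), and each of the four kernel pieces is
a complementary-pair count on the spectator minors (`typedCount_eq_sum_spec`) that the
corresponding row makes nonnegative.  With `u` unmarked this is the `{U, b}` attachment, so of the
three non-vanishing degree-2 attachments `{root, b}`, `{U, b}`, `{U, root}` only the last — NEG-191's
— lies outside the rows.  Corollaries: `superadditivity_ob_of_rows`
(`2 N_τ(F ∖ e) + 2 N_τ(F ∖ f) ≤ N_τ`) and `typedCount_nonneg_ob_of_rows` (row 2′TRI at the instance
from the rows and row 2′TRI at the two deletions — a conditional reduction rule).  Own work;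
standard axioms; CONDITIONAL on the four open row instances.
-/

namespace Summit.Ventures.PercRepro2

namespace CovForm

namespace TypedRed

open OneTyped OProbe Untouched TypedA3

section Main

open Classical

variable {V : Type*} {E : Type*} [Fintype E] [DecidableEq E] {R : Type*} [Field R] [LinearOrder R]
  [IsStrictOrderedRing R]

variable (ends : E → Sym2 V) (o a₁ a₂ a₃ b : V)

/-- **The double-attachment class of `o ~ {u, b}` (ANY second neighbour `u`) is nonnegative under
the two two-copy rows in both root orientations**: `CrossCount a₁ a₂ b a₃`, `SameCount a₂ a₁ b a₃`,
`CrossCount a₂ a₁ b a₃`, `SameCount a₁ a₂ b a₃`. With `u = a₁` the mirror rows are idle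
(`doubleClass_lb_nonneg_of_rows`); with `u` an unmarked vertex this is the `{U, b}` attachment of
NIGHT3-CERT.md §25.7 — so among the three non-vanishing degree-2 attachments only `{U, root}`
(NEG-191's) is outside the rows. -/
theorem doubleClass_ob_nonneg_of_rows {e f : E} {u : V} (he : ends e = s(o, u))
    (hf : ends f = s(o, b)) (hou : o ≠ u) (hef : e ≠ f) (ho1 : o ≠ a₁) (ho2 : o ≠ a₂) (ho3 : o ≠ a₃)
    (hob : o ≠ b) (F : Finset E) (z : Config E) (τ : E → ℕ) (hτ : ∀ e' ∈ F, τ e' = 1 ∨ τ e' = 2)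
    (hcl : ∀ e', e' ≠ e → e' ≠ f → o ∈ ends e' → e' ∉ F ∧ z e' = false)
    (hC : CrossCount R ends a₁ a₂ b a₃) (hS : SameCount (R := R) ends a₂ a₁ b a₃)
    (hCm : CrossCount R ends a₂ a₁ b a₃) (hSm : SameCount (R := R) ends a₁ a₂ b a₃) :
    0 ≤ doubleClass F z τ e f (K3 ends o a₁ a₂ a₃ b : Config E → Config E → Config E → R) := by
  set K : Config E → Config E → Config E → R := K3 ends o a₁ a₂ a₃ b with hK
  set F₂ := (F.erase e).erase f with hF₂
  set z₂ := Function.update (Function.update z e false) f false with hz₂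
  have hτ₂ : ∀ e' ∈ F₂, τ e' = 1 ∨ τ e' = 2 := fun e' he' =>
    hτ e' (Finset.mem_of_mem_erase (Finset.mem_of_mem_erase he'))
  set X : Config E → Config E := fun x => upd2 x e f true true with hX
  set Y : Config E → Config E := fun x => upd2 x e f false false with hY
  have t2 : typedCount F₂ z₂ τ (fun x y w => K (Y x) (X y) (Y w)) =
      typedCount F₂ z₂ τ (fun x y w => K (Y y) (X x) (Y w)) :=
    typedCount_swap12 F₂ z₂ τ (fun x y w => K (Y y) (X x) (Y w))
  have t3 : typedCount F₂ z₂ τ (fun x y w => K (Y x) (Y y) (X w)) =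
      typedCount F₂ z₂ τ (fun x y w => K (Y y) (Y w) (X x)) := by
    rw [typedCount_swap13 F₂ z₂ τ hτ₂ (fun x y w => K (Y w) (Y y) (X x))]
    exact typedCount_swap23 F₂ z₂ τ hτ₂ (fun x y w => K (Y y) (Y w) (X x))
  have s1 : typedCount F₂ z₂ τ (fun x y w => K (X x) (Y y) (Y w)) =
      typedCount F₂ z₂ τ (fun x y w => K (X x) (Y w) (Y y)) :=
    (typedCount_swap23 F₂ z₂ τ hτ₂ (fun x y w => K (X x) (Y y) (Y w))).symm
  have s2 : typedCount F₂ z₂ τ (fun x y w => K (Y y) (X x) (Y w)) =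
      typedCount F₂ z₂ τ (fun x y w => K (Y w) (X x) (Y y)) :=
    (typedCount_swap23 F₂ z₂ τ hτ₂ (fun x y w => K (Y y) (X x) (Y w))).symm
  have s3 : typedCount F₂ z₂ τ (fun x y w => K (Y y) (Y w) (X x)) =
      typedCount F₂ z₂ τ (fun x y w => K (Y w) (Y y) (X x)) :=
    (typedCount_swap23 F₂ z₂ τ hτ₂ (fun x y w => K (Y y) (Y w) (X x))).symm
  have hD : 2 * doubleClass F z τ e f K = typedCount F₂ z₂ τ (fun x y w =>
      K (X x) (Y y) (Y w) + K (X x) (Y w) (Y y) + K (Y y) (X x) (Y w) + K (Y y) (Y w) (X x) +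
        K (Y w) (X x) (Y y) + K (Y w) (Y y) (X x)) := by
    rw [typedCount_add, typedCount_add, typedCount_add, typedCount_add, typedCount_add]
    unfold doubleClass term
    rw [← hF₂, ← hz₂]
    have e1 : (fun x y w => K (upd2 x e f true true) (upd2 y e f false false)
        (upd2 w e f false false)) = fun x y w => K (X x) (Y y) (Y w) := rfl
    have e2 : (fun x y w => K (upd2 x e f false false) (upd2 y e f true true)
        (upd2 w e f false false)) = fun x y w => K (Y x) (X y) (Y w) := rfl
    have e3 : (fun x y w => K (upd2 x e f false false) (upd2 y e f false false)
        (upd2 w e f true true)) = fun x y w => K (Y x) (Y y) (X w) := rfl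
    rw [e1, e2, e3, t2, t3]
    linear_combination s1 + s2 + s3
  set S := st ends o a₁ a₂ a₃ b with hSt
  have hsym : typedCount F₂ z₂ τ (fun x y w =>
      K (X x) (Y y) (Y w) + K (X x) (Y w) (Y y) + K (Y y) (X x) (Y w) + K (Y y) (Y w) (X x) +
        K (Y w) (X x) (Y y) + K (Y w) (Y y) (X x)) =
      typedCount F₂ z₂ τ (fun x y w => ((KBsym (S (X x)) (S (Y y)) (S (Y w)) : ℤ) : R)) := by
    refine typedCount_congr_K _ _ _ fun x y w => ?_
    simp only [hK, K3_eq_KB, ← hSt, KBsym]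
    push_cast
    ring
  have hiso : ∀ (x : Config E), (∀ e', e' ∉ F₂ → x e' = z₂ e') →
      (S (Y x)).Lo = false ∧ (S (Y x)).Ho = false := by
    intro x hx
    have hx' := (support_closed ends o F z hcl hef x hx).1
    have := st_two_closed_e ends o a₁ a₂ a₃ b he hou hef ho1 ho2 ho3 hob hx'
    simp only [hY, upd2, hSt]
    rw [this]
    exact ⟨killO_Lo _, killO_Ho _⟩
  have hconnX : ∀ x : Config E, Conn ends (X x) o b := by
    intro x
    refine conn_of_openAdj ⟨f, ?_, hf⟩
    simp [hX, upd2, Function.update_of_ne hef.symm]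
  -- the probe, split by the side of `o` in the probe copy
  set cp : Config E → R := fun x =>
    if (S (X x)).q' = true then (0 : R) else
      if (S (X x)).Lo = true then ((pdB (S (X x)) : ℤ) : R) * 2 else 0 with hcp
  set cm : Config E → R := fun x =>
    if (S (X x)).q' = true then (0 : R) else
      if (S (X x)).Lo = true then 0 else
        if (S (X x)).Ho = true then ((pdB (S (X x)) : ℤ) : R) * 2 else 0 with hcm
  set P0 : Config E → Config E → Config E → R := fun x y w =>
    if (S (X x)).q' = true then (0 : R) else
      if (S (X x)).Lo = true then
        ((lbP1 (S (X x)) (S (Y y)) (S (Y w)) + pdB (S (X x)) * (2 * lbA (S (Y y)) (S (Y w))) : ℤ) : R)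
      else if (S (X x)).Ho = true then
        ((lbP1m (S (X x)) (S (Y y)) (S (Y w)) + pdB (S (X x)) * (2 * lbAm (S (Y y)) (S (Y w))) : ℤ) : R)
      else 0 with hP0
  set Pc : Config E → Config E → Config E → R := fun x y w =>
    cp x * ((crossB (S (Y y)) (S (Y w)) : ℤ) : R) with hPc
  set Ps : Config E → Config E → Config E → R := fun x y w =>
    cp x * ((sameB (S (Y y)) (S (Y w)) : ℤ) : R) with hPs
  set Pcm : Config E → Config E → Config E → R := fun x y w =>
    cm x * ((crossBm (S (Y y)) (S (Y w)) : ℤ) : R) with hPcm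
  set Psm : Config E → Config E → Config E → R := fun x y w =>
    cm x * ((sameBm (S (Y y)) (S (Y w)) : ℤ) : R) with hPsm
  have hprobe : typedCount F₂ z₂ τ (fun x y w => ((KBsym (S (X x)) (S (Y y)) (S (Y w)) : ℤ) : R)) =
      typedCount F₂ z₂ τ (fun x y w => P0 x y w + Pc x y w + Ps x y w + Pcm x y w + Psm x y w) := by
    refine typedCount_congr_K_on _ _ _ fun x y w hxyw _ => ?_
    have hy := hiso y fun e' he' => (hxyw e' he').2.1
    have hw := hiso w fun e' he' => (hxyw e' he').2.2
    rw [KBsym_eq_probe_isolated _ _ _ hy hw]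
    simp only [hP0, hPc, hPs, hPcm, hPsm, hcp, hcm]
    have hcy := st_consistent ends o a₁ a₂ a₃ b (Y y)
    have hcw := st_consistent ends o a₁ a₂ a₃ b (Y w)
    obtain ⟨hLb, hHb⟩ := st_ob_bits ends o a₁ a₂ a₃ b (X x) (hconnX x)
    by_cases hq : (S (X x)).q' = true
    · rw [probeB_q' _ _ _ hq]
      simp [hq]
    · have hq' : (S (X x)).q' = false := by simpa using hq
      by_cases hLo : (S (X x)).Lo = true
      · have hHo : (S (X x)).Ho = false := by
          by_contra h
          exact hq (st_consistent_o ends o a₁ a₂ a₃ b (X x) hLo (by simpa using h))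
        rw [probeB_lb _ _ _ ⟨hLo, hHo, by rw [hLb]; exact hLo, by rw [hHb]; exact hHo⟩ hcy hcw]
        simp only [hq, hLo, if_true]
        push_cast
        ring
      · have hLo' : (S (X x)).Lo = false := by simpa using hLo
        by_cases hHo : (S (X x)).Ho = true
        · rw [probeB_hb _ _ _ ⟨hLo', hHo, by rw [hLb]; exact hLo', by rw [hHb]; exact hHo⟩ hcy hcw]
          simp only [hq, hLo, hHo, if_true]
          push_cast
          ring
        · have hHo' : (S (X x)).Ho = false := by simpa using hHo
          rw [probeB_isolated _ _ _ ⟨hLo', hHo'⟩]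
          simp [hq, hLo, hHo]
  have cp_nonneg : ∀ x : Config E, 0 ≤ cp x := by
    intro x
    simp only [hcp]
    split_ifs
    · exact le_rfl
    · exact mul_nonneg (by exact_mod_cast pdB_nonneg _) (by norm_num)
    · exact le_rfl
  have cm_nonneg : ∀ x : Config E, 0 ≤ cm x := by
    intro x
    simp only [hcm]
    split_ifs
    · exact le_rfl
    · exact le_rfl
    · exact mul_nonneg (by exact_mod_cast pdB_nonneg _) (by norm_num)
    · exact le_rfl
  have heF₂ : e ∉ F₂ := fun h => Finset.notMem_erase e F (Finset.mem_of_mem_erase h)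
  have hfF₂ : f ∉ F₂ := Finset.notMem_erase f _
  have hYfix : ∀ (x y : Config E), (∀ e', e' ∉ specFree F₂ τ x → y e' = specPin F₂ z₂ τ x e') →
      Y y = y ∧ Y (flipOn (specFree F₂ τ x) y) = flipOn (specFree F₂ τ x) y := by
    intro x y hy
    have heG : e ∉ specFree F₂ τ x := fun h => heF₂ (specFree_subset F₂ τ x h)
    have hfG : f ∉ specFree F₂ τ x := fun h => hfF₂ (specFree_subset F₂ τ x h)
    have hye : y e = false := by
      rw [hy e heG, specPin_of_notMem heF₂, hz₂, Function.update_of_ne hef, Function.update_self]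
    have hyf : y f = false := by
      rw [hy f hfG, specPin_of_notMem hfF₂, hz₂, Function.update_self]
    have u1 : Function.update y f false = y := Function.update_eq_self_iff.2 hyf.symm
    have u2 : Function.update y e false = y := Function.update_eq_self_iff.2 hye.symm
    have u3 : Function.update (flipOn (specFree F₂ τ x) y) f false = flipOn (specFree F₂ τ x) y :=
      Function.update_eq_self_iff.2 (by rw [flipOn_of_notMem _ _ hfG]; exact hyf.symm)
    have u4 : Function.update (flipOn (specFree F₂ τ x) y) e false = flipOn (specFree F₂ τ x) y :=
      Function.update_eq_self_iff.2 (by rw [flipOn_of_notMem _ _ heG]; exact hye.symm)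
    constructor
    · simp only [hY, upd2]
      rw [u1, u2]
    · simp only [hY, upd2]
      rw [u3, u4]
  -- a generic spectator piece
  have piece : ∀ (c : Config E → R) (hc : ∀ x, 0 ≤ c x) (B : St → St → ℤ)
      (Kc : Config E → Config E → R) (hB : ∀ y w, Kc y w = ((B (S y) (S w) : ℤ) : R))
      (hrow : ∀ (G : Finset E) (z' : Config E), 0 ≤ pinnedCount G z' Kc),
      0 ≤ typedCount F₂ z₂ τ (fun x y w => c x * ((B (S (Y y)) (S (Y w)) : ℤ) : R)) := by
    intro c hc B Kc hB hrow
    rw [typedCount_eq_sum_spec F₂ z₂ τ hτ₂]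
    refine Finset.sum_nonneg fun x _ => ?_
    split_ifs with hx
    · have hpc : pinnedCount (specFree F₂ τ x) (specPin F₂ z₂ τ x)
          (fun y w => c x * ((B (S (Y y)) (S (Y w)) : ℤ) : R)) =
          c x * pinnedCount (specFree F₂ τ x) (specPin F₂ z₂ τ x) Kc := by
        rw [pinnedCount_const_mul]
        congr 1
        refine pinnedCount_congr_on _ _ _ _ fun y hy => ?_
        obtain ⟨h1, h2⟩ := hYfix x y hy
        rw [h1, h2, hB]
      rw [hpc]
      exact mul_nonneg (hc x) (hrow _ _)
    · exact le_rfl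
  -- assemble
  rw [← mul_nonneg_iff_of_pos_left (show (0 : R) < 2 by norm_num), hD, hsym, hprobe,
    typedCount_add, typedCount_add, typedCount_add, typedCount_add]
  refine add_nonneg (add_nonneg (add_nonneg (add_nonneg ?_ ?_) ?_) ?_) ?_
  · refine typedCount_nonneg_of_nonneg _ _ _ _ fun x y w => ?_
    simp only [hP0]
    split_ifs
    · exact le_rfl
    · exact_mod_cast add_nonneg (lbP1_nonneg _ _ _)
        (mul_nonneg (pdB_nonneg _) (mul_nonneg (by norm_num) (lbA_nonneg _ _)))
    · exact_mod_cast add_nonneg (lbP1m_nonneg _ _ _)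
        (mul_nonneg (pdB_nonneg _) (mul_nonneg (by norm_num) (lbAm_nonneg _ _)))
    · exact le_rfl
  · exact piece cp cp_nonneg crossB (crossKernel (R := R) ends a₁ a₂ b a₃)
      (fun y w => by rw [crossKernel_eq_crossB ends o a₁ a₂ a₃ b, ← hSt]) hC
  · exact piece cp cp_nonneg sameB (sameKernel (R := R) ends a₂ a₁ b a₃)
      (fun y w => by rw [sameKernel_eq_sameB ends o a₁ a₂ a₃ b, ← hSt]) hS
  · exact piece cm cm_nonneg crossBm (crossKernel (R := R) ends a₂ a₁ b a₃)
      (fun y w => by rw [crossKernel_eq_crossBm ends o a₁ a₂ a₃ b, ← hSt]) hCm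
  · exact piece cm cm_nonneg sameBm (sameKernel (R := R) ends a₁ a₂ b a₃)
      (fun y w => by rw [sameKernel_eq_sameBm ends o a₁ a₂ a₃ b, ← hSt]) hSm

/-- **Superadditivity at `o ~ {u, b}` from the two-copy rows (both orientations)**:
`2 N_τ(F ∖ e) + 2 N_τ(F ∖ f) ≤ N_τ`. -/
theorem superadditivity_ob_of_rows {e f : E} {u : V} (he : ends e = s(o, u))
    (hf : ends f = s(o, b)) (hou : o ≠ u) (hef : e ≠ f) (ho1 : o ≠ a₁) (ho2 : o ≠ a₂) (ho3 : o ≠ a₃)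
    (hob : o ≠ b) (F : Finset E) (heF : e ∈ F) (hfF : f ∈ F) (z : Config E) (τ : E → ℕ)
    (hτ : ∀ e' ∈ F, τ e' = 1 ∨ τ e' = 2) (hτe : τ e = 1) (hτf : τ f = 1)
    (hcl : ∀ e', e' ≠ e → e' ≠ f → o ∈ ends e' → e' ∉ F ∧ z e' = false)
    (hC : CrossCount R ends a₁ a₂ b a₃) (hS : SameCount (R := R) ends a₂ a₁ b a₃)
    (hCm : CrossCount R ends a₂ a₁ b a₃) (hSm : SameCount (R := R) ends a₁ a₂ b a₃) :
    2 * typedCount (F.erase e) (Function.update z e false) τ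
        (K3 ends o a₁ a₂ a₃ b : Config E → Config E → Config E → R) +
      2 * typedCount (F.erase f) (Function.update z f false) τ (K3 ends o a₁ a₂ a₃ b) ≤
      typedCount F z τ (K3 ends o a₁ a₂ a₃ b : Config E → Config E → Config E → R) :=
  (doubleClass_nonneg_iff (R := R) ends o a₁ a₂ a₃ b he hf hou hob hef ho1 ho2 ho3 hob F heF hfF z
    τ hτe hτf hcl).1 (doubleClass_ob_nonneg_of_rows ends o a₁ a₂ a₃ b he hf hou hef ho1 ho2 ho3 hob
    F z τ hτ hcl hC hS hCm hSm)

/-- **A conditional reduction rule for the typed bases**: at a mark `o` of typed degree two with an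
edge to `b` (the other to any `u`), row 2′TRI on the instance follows from the four row instances
and row 2′TRI on the two deletions (`o` pendant at `u`, resp. at `b` — by the pendant rule the
contractions `o := u`, `o := b`). -/
theorem typedCount_nonneg_ob_of_rows {e f : E} {u : V} (he : ends e = s(o, u))
    (hf : ends f = s(o, b)) (hou : o ≠ u) (hef : e ≠ f) (ho1 : o ≠ a₁) (ho2 : o ≠ a₂) (ho3 : o ≠ a₃)
    (hob : o ≠ b) (F : Finset E) (heF : e ∈ F) (hfF : f ∈ F) (z : Config E) (τ : E → ℕ)
    (hτ : ∀ e' ∈ F, τ e' = 1 ∨ τ e' = 2) (hτe : τ e = 1) (hτf : τ f = 1)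
    (hcl : ∀ e', e' ≠ e → e' ≠ f → o ∈ ends e' → e' ∉ F ∧ z e' = false)
    (hC : CrossCount R ends a₁ a₂ b a₃) (hS : SameCount (R := R) ends a₂ a₁ b a₃)
    (hCm : CrossCount R ends a₂ a₁ b a₃) (hSm : SameCount (R := R) ends a₁ a₂ b a₃)
    (hNe : 0 ≤ typedCount (F.erase e) (Function.update z e false) τ
      (K3 ends o a₁ a₂ a₃ b : Config E → Config E → Config E → R))
    (hNf : 0 ≤ typedCount (F.erase f) (Function.update z f false) τ
      (K3 ends o a₁ a₂ a₃ b : Config E → Config E → Config E → R)) :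
    0 ≤ typedCount F z τ (K3 ends o a₁ a₂ a₃ b : Config E → Config E → Config E → R) := by
  have h := superadditivity_ob_of_rows ends o a₁ a₂ a₃ b he hf hou hef ho1 ho2 ho3 hob F heF hfF z
    τ hτ hτe hτf hcl hC hS hCm hSm
  linarith

end Main

end TypedRed

end CovForm

end Summit.Ventures.PercRepro2
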